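import Mathlib
import Summits.Ventures.Crystal3D.Theorems.StickyWulffConstantTextureLiminfTentBilayerCertificate
import Summits.Ventures.Crystal3D.Theorems.StickyWulffConstantTextureLiminfTentBarlowCount
import Summits.Ventures.Crystal3D.Theorems.StickyWulffConstantTextureLiminfTentBarlowBonds
import Literature.Analysis.Convexity.FinitePerimeterTransform
import HarnessLib

/-!
# Line `TexShadow` (crux `TextureLiminf`, stmt-Ventures-19483): the registered stub `stub_barlowFreeCertificate` — PROVED

HONEST FRAMING. Part of the venture `Summits/Ventures/Crystal3D` (cell `crystal3d-full`), route
`route-Ventures-StickyWulffConstant`, crux `TextureLiminf` (stmt-Ventures-19483).  Proves, with no `sorry` and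
standard axioms, the registered stub `stub_barlowFreeCertificate : BarlowFreeCertificate` of the planner's skeleton
`HOME/cf-p1/route/lines/tex/TexShadow.lean` (v6.2) BY NAME, against the verbatim vocabulary files
`…TexShadowVocabulary.lean` / `…TexShadowCertificateDefs.lean` — for EVERY Hägg word (fcc, hcp, any Barlow
stacking), every frame, every table of bilayer frames, every finite atom set and every open set.

THE BARLOW TENT, assembled bilayer by bilayer (eng g8/g9; ROUTE.md §72).  For each bilayer `i` of the moved
stacking take the rigid motion `Φ_i = T_i · + c_i` of `…TentBarlowFrames.lean` carrying the cubic bilayer onto it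
(slab onto slab, layers onto layers, `T_i '' W_fcc = wulffOf (A i)` for every admissible frame `A i`), pull the
atoms back (`pullback`), and run the cubic ONE-SLAB certificate `tent_bilayer_certificate` (generic level chosen
independently per bilayer — the slab-wise perimeters of the stub only test fields supported in the OPEN slabs, so
no continuity across layer planes is needed): pieces inside the slab, within `√2` of the atoms, a.e. containing the
fully surrounded slab points, `4 C_i ≤ #IP_i + 2 #IL_i`.  `G` is the union of the moved pieces over the finitely
many occupied bilayers.  Finite perimeter / volume / polytope clauses transport piece by piece
(`…TentBarlowCount.lean`); the mass clause holds off the null layer planes; slab `i` of the perimeter clause is,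
after localisation to `G ∩ laySlab i = Φ_i(pieces_i)` and lit's `anisotropicPerimeterIn_rigidMotion`, the cubic
bound `≤ C_i`; and `Σ_i (#IP_i + 2 #IL_i) ≤ 2 · brokenNearIn S X U` is the bilayer double count
(`sum_ncard_le_two_mul_ncard`: an in-plane broken bond is seen by its two bilayers, charged `¼` each, an
inter-layer one by its own bilayer, charged `½`).
WHAT THIS IS NOT: any progress on `stub_textureBuild`, `stub_bilayerWall`, `stub_barlowAdhesionR`,
`stub_resolution`; rung F-C1 not moved.
-/

noncomputable section

open scoped BigOperators InnerProductSpace ENNReal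
open MeasureTheory Filter

namespace Summit.Ventures.Crystal3D.Cruxes.TextureLiminf.TexShadow

open Summit.Ventures.Crystal3D Summit.Ventures.Crystal3D.TentCertificate Literature.Analysis.Convexity
open Literature.MathematicalPhysics.StatisticalMechanics (fccStacking barlowStacking IsHaggSeq
  fieldDivergence HasFinitePerimeter fccWulffBody)

/-- The cubic slab `0` is the slab of the one-slab certificate. -/
theorem mem_cubicSlab_zero (x : E3) :
    x ∈ cubicSlab 0 ↔ 0 < ⟪Literature.Geometry.DiscreteGeometry.intVec (normal4 0), Real.sqrt 2 • x⟫_ℝ ∧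
      ⟪Literature.Geometry.DiscreteGeometry.intVec (normal4 0), Real.sqrt 2 • x⟫_ℝ < 2 := by
  simp [cubicSlab]

/-- A rigid motion carries null sets to null sets. -/
theorem volume_image_motion_null (T : E3 ≃ₗᵢ[ℝ] E3) (c : E3) {A : Set E3} (hA : volume A = 0) :
    volume ((fun x => T x + c) '' A) = 0 := by
  have h1 : volume (T '' A) = 0 := by
    have himg : T '' A = T.symm ⁻¹' A := by
      ext y
      simp only [Set.mem_image, Set.mem_preimage]
      constructor
      · rintro ⟨x, hx, rfl⟩; simpa using hx
      · intro hy; exact ⟨T.symm y, hy, by simp⟩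
    rw [himg]
    exact T.symm.measurePreserving.quasiMeasurePreserving.preimage_null hA
  have h2 : (fun x => T x + c) '' A = (fun y => y + -c) ⁻¹' (T '' A) := by
    ext y
    simp only [Set.mem_image, Set.mem_preimage]
    constructor
    · rintro ⟨x, hx, rfl⟩; exact ⟨x, hx, by abel⟩
    · rintro ⟨x, hx, hxy⟩; exact ⟨x, hx, by rw [hxy]; abel⟩
  rw [h2]
  exact (measurePreserving_add_right volume (-c)).quasiMeasurePreserving.preimage_null h1

/-- **The registered stub `stub_barlowFreeCertificate` of TexShadow v6.2** — the FREE certificate on a Barlow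
grain (the Barlow tent), for every Hägg word. -/
theorem stub_barlowFreeCertificate : BarlowFreeCertificate := by
  intro σ hσ L s A hA X hXS U hU
  classical
  -- Step 1: bilayer motions and cubic certificates
  choose T c sw hbil hsurj hslab hht hwulff using fun i : ℤ => exists_bilayerMotion hσ L s i
  have hht' : ∀ (i : ℤ) (a : Site), (lay a = 0 ∨ lay a = 1) →
      height L s (T i (site a) + c i) = layerHeight i (sw i) (lay a) := fun i a h => hht i a h
  choose J Hd hbd h1 hd hdj hsl hfp hball hmass C hC0 hC4 hCint using
    fun i : ℤ => tent_bilayer_certificate (pullback (T i) (c i) X) ((fun x => T i x + c i) ⁻¹' U)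
  -- Step 2: the finitely many occupied bilayers
  set I : Finset ℤ := (X.image fun x => ⌊height L s x / hB⌋) ∪ (X.image fun x => ⌊height L s x / hB⌋ - 1)
    with hI
  have hI_of_mem : ∀ (i : ℤ) (a : Site), a ∈ pullback (T i) (c i) X → i ∈ I := by
    intro i a ha
    obtain ⟨x, hx, h | h⟩ := exists_floor_of_pullback_nonempty (hht' i) ha
    · exact Finset.mem_union_left _ (Finset.mem_image.2 ⟨x, hx, h.symm⟩)
    · exact Finset.mem_union_right _ (Finset.mem_image.2 ⟨x, hx, h.symm⟩)
  have hempty : ∀ i, i ∉ I → pullback (T i) (c i) X = ∅ := fun i hi =>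
    Finset.eq_empty_of_forall_notMem fun a ha => hi (hI_of_mem i a ha)
  -- cubic pieces of bilayer `i` are inhabited only for `i ∈ I`
  have hpiece_mem : ∀ (i : ℤ) (j : Fin (J i)) (x : E3), x ∈ polytope (Hd i j) → i ∈ I := by
    intro i j x hx
    obtain ⟨a, ha, -⟩ := Set.mem_iUnion₂.1 (hball i (Set.mem_iUnion.2 ⟨j, hx⟩))
    exact hI_of_mem i a ha
  -- slabs
  have hslab0 : ∀ (i : ℤ) (j : Fin (J i)), polytope (Hd i j) ⊆ cubicSlab 0 :=
    fun i j x hx => (mem_cubicSlab_zero x).2 (hsl i j hx)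
  have hmoved_slab : ∀ (i : ℤ) (j : Fin (J i)),
      (fun x => T i x + c i) '' polytope (Hd i j) ⊆ laySlab L s i := by
    intro i j; rw [← hslab i]; exact Set.image_mono (hslab0 i j)
  -- Step 3: the family of moved pieces
  let K := Σ i : I, Fin (J i)
  let Hd' : K → Finset (E3 × ℝ) := fun k => moveH (T k.1) (c k.1) (Hd k.1 k.2)
  have hHd' : ∀ k : K, polytope (Hd' k) = (fun x => T k.1 x + c k.1) '' polytope (Hd k.1 k.2) :=
    fun k => (image_polytope_motion _ _ _).symm
  let e := Fintype.equivFin K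
  let H : Fin (Fintype.card K) → Finset (E3 × ℝ) := fun j => Hd' (e.symm j)
  set G : Set E3 := ⋃ j, polytope (H j) with hG
  have hGK : G = ⋃ k : K, polytope (Hd' k) := e.symm.surjective.iUnion_comp fun k => polytope (Hd' k)
  -- disjointness of the moved pieces
  have hdisjK : ∀ k k' : K, k ≠ k' → Disjoint (polytope (Hd' k)) (polytope (Hd' k')) := by
    rintro ⟨⟨i, hi⟩, j⟩ ⟨⟨i', hi'⟩, j'⟩ hne
    rw [hHd', hHd']
    by_cases hii : i = i'
    · subst hii
      have hjj : j ≠ j' := fun h => hne (by subst h; rfl)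
      exact (Set.disjoint_image_iff (injective_motion (T i) (c i))).2 (hdj i j j' hjj)
    · exact (disjoint_laySlab L s hii).mono (hmoved_slab i j) (hmoved_slab i' j')
  -- the slab-`i` part of `G`
  have hGslab : ∀ i : ℤ, i ∈ I →
      G ∩ laySlab L s i = (fun x => T i x + c i) '' ⋃ j, polytope (Hd i j) := by
    intro i hi
    apply Set.Subset.antisymm
    · rintro y ⟨hyG, hyi⟩
      rw [hGK] at hyG
      obtain ⟨⟨⟨i', hi'⟩, j⟩, hy⟩ := Set.mem_iUnion.1 hyG
      rw [hHd'] at hy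
      have hii : i' = i := by
        by_contra hne
        exact Set.disjoint_left.1 (disjoint_laySlab L s hne) (hmoved_slab i' j hy) hyi
      subst hii
      rw [Set.image_iUnion]; exact Set.mem_iUnion.2 ⟨j, hy⟩
    · rintro y hy
      rw [Set.image_iUnion] at hy
      obtain ⟨j, hj⟩ := Set.mem_iUnion.1 hy
      refine ⟨?_, hmoved_slab i j hj⟩
      rw [hGK]
      exact Set.mem_iUnion.2 ⟨⟨⟨i, hi⟩, j⟩, by rw [hHd']; exact hj⟩
  have hGslab' : ∀ i : ℤ, i ∉ I → G ∩ laySlab L s i = ∅ := by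
    intro i hi
    ext y
    simp only [Set.mem_inter_iff, Set.mem_empty_iff_false, iff_false, not_and]
    intro hyG hyi
    rw [hGK] at hyG
    obtain ⟨⟨⟨i', hi'⟩, j⟩, hy⟩ := Set.mem_iUnion.1 hyG
    rw [hHd'] at hy
    have hii : i' = i := by
      by_contra hne
      exact Set.disjoint_left.1 (disjoint_laySlab L s hne) (hmoved_slab i' j hy) hyi
    subst hii; exact hi hi'
  -- the per-piece clauses
  have cbdd : ∀ j, Bornology.IsBounded (polytope (H j)) := fun j => isBounded_polytope_moveH (hbd _ _)
  have cunit : ∀ j, ∀ p ∈ H j, ‖p.1‖ = 1 := fun j => norm_moveH (h1 _ _)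
  have cdist : ∀ j, ∀ p ∈ H j, ∀ p' ∈ H j, p ≠ p' →
      {x : E3 | ⟪p.1, x⟫_ℝ = p.2} ≠ {x | ⟪p'.1, x⟫_ℝ = p'.2} := fun j => plane_ne_moveH (hd _ _)
  have cdisj : ∀ j j', j ≠ j' → Disjoint (polytope (H j)) (polytope (H j')) :=
    fun j j' hjj => hdisjK _ _ fun h => hjj (e.symm.injective h)
  have cfin : HasFinitePerimeter G :=
    hasFinitePerimeter_iUnion_of_pairwise_disjoint
      (fun j => hasFinitePerimeter_polytope (H j) (cbdd j) (cunit j) (cdist j)) fun j j' hjj => cdisj j j' hjj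
  have cvol : volume G < ⊤ :=
    (measure_iUnion_fintype_le volume _).trans_lt (ENNReal.sum_lt_top.2 fun j _ => (cbdd j).measure_lt_top)
  -- Wulff bodies of the given frames
  have hW : ∀ i, wulffOf (A i) = T i '' fccWulffBody := by
    intro i; obtain ⟨u, hu⟩ := hA i; exact hwulff i (A i) u hu
  refine ⟨G, cfin, cvol, ?_, ⟨Fintype.card K, H, cbdd, cunit, cdist, cdisj, ?_, rfl⟩, ?_, ?_⟩
  · -- within `√2` of the atoms
    intro y hy
    rw [hGK] at hy
    obtain ⟨⟨⟨i, hi⟩, j⟩, hy⟩ := Set.mem_iUnion.1 hy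
    rw [hHd'] at hy
    obtain ⟨x, hx, rfl⟩ := hy
    obtain ⟨a, ha, hxa⟩ := Set.mem_iUnion₂.1 (hball i (Set.mem_iUnion.2 ⟨j, hx⟩))
    refine Set.mem_iUnion₂.2 ⟨T i (site a) + c i, (mem_pullback.1 ha).2, ?_⟩
    rw [Metric.mem_closedBall] at hxa ⊢
    rwa [dist_add_right, LinearIsometryEquiv.dist_map]
  · -- every piece lies in one open layer slab
    intro j
    refine ⟨(e.symm j).1, ?_⟩
    show polytope (Hd' (e.symm j)) ⊆ _
    rw [hHd']; exact hmoved_slab _ _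
  · -- mass: off the null layer planes, a fully surrounded point of slab `i` pulls back to a fully surrounded
    -- point of the cubic slab, hence lies in the cubic pieces up to a null set
    have hnull : volume ((⋃ k : ℤ, {y : E3 | height L s y = k * hB}) ∪
        ⋃ i : ℤ, (fun x => T i x + c i) ''
          ({y : E3 | (0 < ⟪Literature.Geometry.DiscreteGeometry.intVec (normal4 0), Real.sqrt 2 • y⟫_ℝ ∧
              ⟪Literature.Geometry.DiscreteGeometry.intVec (normal4 0), Real.sqrt 2 • y⟫_ℝ < 2) ∧
              ∀ a : Site, (lay a = 0 ∨ lay a = 1) → dist y (site a) ≤ Real.sqrt 2 → a ∈ pullback (T i) (c i) X} \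
            ⋃ j, polytope (Hd i j))) = 0 := by
      refine measure_union_null (volume_iUnion_planes L s) ((measure_iUnion_null_iff).2 fun i => ?_)
      exact volume_image_motion_null (T i) (c i) (hmass i)
    refine measure_mono_null ?_ hnull
    rintro y ⟨hyM, hyG⟩
    by_cases hpl : ∃ k : ℤ, height L s y = k * hB
    · obtain ⟨k, hk⟩ := hpl; exact Or.inl (Set.mem_iUnion.2 ⟨k, hk⟩)
    push Not at hpl
    have hyi : y ∈ laySlab L s ⌊height L s y / hB⌋ := mem_laySlab_floor L s hpl
    generalize hi : ⌊height L s y / hB⌋ = i at hyi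
    rw [← hslab i] at hyi
    obtain ⟨x, hx0, hxy⟩ := hyi
    refine Or.inr (Set.mem_iUnion.2 ⟨i, x, ⟨⟨(mem_cubicSlab_zero x).1 hx0, fun a ha hda => ?_⟩,
      fun hxP => hyG ?_⟩, hxy⟩)
    · refine mem_pullback.2 ⟨ha, hyM _ (bilayer_subset_stacking L s σ i (hbil i a ha)) ?_⟩
      rw [← hxy, dist_add_right, LinearIsometryEquiv.dist_map]; exact hda
    · obtain ⟨j, hj⟩ := Set.mem_iUnion.1 hxP
      have hiI : i ∈ I := hpiece_mem i j x hj
      rw [hGK]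
      exact Set.mem_iUnion.2 ⟨⟨⟨i, hiI⟩, j⟩, by rw [hHd']; exact ⟨x, hj, hxy⟩⟩
  · -- the slab-wise Wulff perimeters
    have hper : ∀ i : ℤ, perKIn (wulffOf (A i)) G (U ∩ laySlab L s i) ≤ ENNReal.ofReal (C i) := by
      intro i
      rw [perKIn_eq_anisotropicPerimeterIn, anisotropicPerimeterIn_inter_of_subset _ _
        (isOpen_laySlab L s i).measurableSet Set.inter_subset_right]
      by_cases hi : i ∈ I
      · rw [hGslab i hi, hW i]
        have hUV : U ∩ laySlab L s i =
            (fun x => T i x + c i) '' (((fun x => T i x + c i) ⁻¹' U) ∩ cubicSlab 0) := by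
          rw [Set.image_preimage_inter, hslab i]
        rw [hUV, anisotropicPerimeterIn_rigidMotion]
        refine anisotropicPerimeterIn_le_iff.2 fun ξ hξ1 hξ2 hξ3 hξ4 => ENNReal.ofReal_le_ofReal ?_
        exact hCint i ξ hξ1 hξ2 hξ3
          (hξ4.trans (Set.inter_subset_inter_right _ fun x hx => (mem_cubicSlab_zero x).1 hx))
      · rw [hGslab' i hi, anisotropicPerimeterIn_empty]; exact bot_le
    have hC_zero : ∀ i, i ∉ I → C i = 0 := by
      intro i hi
      have h4 := hC4 i
      rw [brokenNearIP_eq_empty_of_pullback (hempty i hi), brokenNearIL_eq_empty_of_pullback (hempty i hi),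
        Set.ncard_empty] at h4
      simp only [Nat.cast_zero, mul_zero, add_zero] at h4
      linarith [hC0 i]
    -- the bilayer double count on the stacking side
    have hBBfin := stackingBonds_finite hσ X hXS U
    have hcount := sum_ncard_le_two_mul_ncard hBBfin (height L s) hB_pos.ne' I
      (fun i => bondMap (T i) (c i) '' brokenNearIP (pullback (T i) (c i) X) ((fun x => T i x + c i) ⁻¹' U))
      (fun i => bondMap (T i) (c i) '' brokenNearIL (pullback (T i) (c i) X) ((fun x => T i x + c i) ⁻¹' U))
      (fun i _ => bondMap_brokenNearIP_subset (hbil i) (hht' i))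
      (fun i _ => bondMap_brokenNearIL_subset (hbil i) (hht' i))
    simp only [ncard_image_bondMap] at hcount
    have hreal : 2 * ∑ i ∈ I, C i ≤ ((stackingBonds (stacking L s σ) X U).ncard : ℝ) := by
      have hsum : 4 * ∑ i ∈ I, C i ≤ ∑ i ∈ I,
          (((brokenNearIP (pullback (T i) (c i) X) ((fun x => T i x + c i) ⁻¹' U)).ncard : ℝ) +
            2 * ((brokenNearIL (pullback (T i) (c i) X) ((fun x => T i x + c i) ⁻¹' U)).ncard : ℝ)) := by
        rw [Finset.mul_sum]; exact Finset.sum_le_sum fun i _ => hC4 i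
      have hcast : (∑ i ∈ I,
          (((brokenNearIP (pullback (T i) (c i) X) ((fun x => T i x + c i) ⁻¹' U)).ncard : ℝ) +
            2 * ((brokenNearIL (pullback (T i) (c i) X) ((fun x => T i x + c i) ⁻¹' U)).ncard : ℝ))) ≤
          2 * ((stackingBonds (stacking L s σ) X U).ncard : ℝ) := by exact_mod_cast hcount
      linarith
    calc 2 * ∑' i, perKIn (wulffOf (A i)) G (U ∩ laySlab L s i)
        ≤ 2 * ∑' i, ENNReal.ofReal (C i) := by gcongr with i; exact hper i
      _ = 2 * ∑ i ∈ I, ENNReal.ofReal (C i) := by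
          rw [tsum_eq_sum (s := I) fun i hi => by rw [hC_zero i hi, ENNReal.ofReal_zero]]
      _ = ENNReal.ofReal (2 * ∑ i ∈ I, C i) := by
          rw [ENNReal.ofReal_mul zero_le_two, ENNReal.ofReal_ofNat, ENNReal.ofReal_sum_of_nonneg fun i _ => hC0 i]
      _ ≤ ENNReal.ofReal ((stackingBonds (stacking L s σ) X U).ncard : ℝ) := ENNReal.ofReal_le_ofReal hreal
      _ = (brokenNearIn (stacking L s σ) X U : ℝ≥0∞) := by rw [brokenNearIn_eq, ENNReal.ofReal_natCast]

end Summit.Ventures.Crystal3D.Cruxes.TextureLiminf.TexShadow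

end
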